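import Mathlib
import Summits.Schanuel.Schanuel.Theses.RigidCore
import Summits.Schanuel.Schanuel.Theorems.MinimalCounterexampleInAcl.Negative.MateTrdeg
import Summits.Schanuel.Schanuel.Theorems.MinimalCounterexampleInAcl.Negative.LocusMates
import Summits.Schanuel.Schanuel.Theorems.MinimalCounterexampleInAcl.Negative.IsolationFree
import Literature.NumberTheory.Transcendental.GammaFields

/-!
# Crux `RigidCore.MinimalCounterexampleInAcl` (stmt-Schanuel-0969), line `span-growth-dichotomy`:
registered stubs T1 `stub_matePredim` and I `stub_isolationFree` (lead c17)

Both registered stubs of the skeleton `Cruxes/MinimalCounterexampleInAcl/Lines/span-growth-dichotomy.lean`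
are stated VERBATIM and proved from the landed crux library
`Summit.Schanuel.Schanuel.Theorems.MinimalCounterexampleInAcl.Negative`:

* `stub_matePredim` (T1): a locus mate `x'` of a first failure `x` of rank `n` has predimension
  `δ(span_ℚ x') ≤ −1` — `mate_trdeg_lt` (relations pull algebraic independence back, so
  `trdeg ℚ(x', e^{x'}) ≤ trdeg ℚ(x, eˣ) < n`) transported along the bridge `predim_le_neg_one_iff`
  (`δ(⟨x'⟩/0) ≤ −1 ↔ trdeg < n` for ℚ-linearly independent `x'`);
* `stub_isolationFree` (I): definable isolation is free — `isolationFree` (the mate set is one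
  `∅`-formula of `ℂ_exp` because `ℤ` is `∅`-definable; its `i`-th projection is finite and `∅`-definable).

## References

* M. Bays, J. Kirby, *Pseudo-exponential maps, variants, and quasiminimality*, Algebra & Number Theory
  12 (2018), arXiv:1512.04262, Def. 4.1 / Lemma 4.2 (predimension `δ`).
* J. Kirby, A. Macintyre, A. Onshuus, *The algebraic numbers definable in various exponential fields*,
  J. Inst. Math. Jussieu 11 (2012), arXiv:1101.4224, §2.2 (`ℤ` is `∅`-definable in `ℂ_exp`).
-/

noncomputable section

set_option linter.dupNamespace false

open Complex Set
open Literature.NumberTheory.Transcendental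
open Literature.ModelTheory.ExponentialFields
open Summit.Schanuel.Schanuel.Theorems.MinimalCounterexampleInAcl.Negative

namespace Summit.Schanuel.Schanuel.Cruxes.MinimalCounterexampleInAcl.SpanGrowthDichotomy

/-- **Stub T1 (registered, verbatim) — mates have predimension `≤ −1`.**  For a first failure `x` of
rank `n` and any `x'` that is ℚ-linearly independent and satisfies every ℚ-polynomial relation of
`(x, eˣ)`, `δ(span_ℚ x') ≤ −1`: by `mate_trdeg_lt`, `trdeg ℚ(x', e^{x'}) < n`, and for ℚ-linearly
independent `x'` this is `δ ≤ −1` (`predim_le_neg_one_iff`). -/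
theorem stub_matePredim :
    ∀ {n : ℕ} {x : Fin n → ℂ},
      (LinearIndependent ℚ x ∧
        Algebra.trdeg ℚ ↥(IntermediateField.adjoin ℚ (Set.range x ∪ Set.range (Complex.exp ∘ x))) <
          (n : Cardinal) ∧
        ∀ r < n, Literature.NumberTheory.Transcendental.SchanuelRank r) →
      ∀ {x' : Fin n → ℂ},
        (LinearIndependent ℚ x' ∧
          ∀ p : MvPolynomial (Fin n ⊕ Fin n) ℚ,
            MvPolynomial.aeval (Sum.elim x (Complex.exp ∘ x)) p = 0 →
              MvPolynomial.aeval (Sum.elim x' (Complex.exp ∘ x')) p = 0) →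
        Literature.NumberTheory.Transcendental.GammaField.predim (⊥ : Submodule ℚ ℂ)
          (Submodule.span ℚ (Set.range x')) ≤ -1 :=
  fun hx _ hx' => (predim_le_neg_one_iff hx'.1).2 (mate_trdeg_lt hx.2.1 hx'.2)

/-- **Stub I (registered, verbatim) — definable isolation is free.**  If the locus mates of a first
failure `x` are finitely many, every coordinate `x i` lies in a finite `∅`-definable subset of
`(ℂ, +, ·, −, 0, 1, exp)` (the landed `isolationFree`; only the linear independence of `x` is used). -/
theorem stub_isolationFree :
    ∀ {n : ℕ} {x : Fin n → ℂ},
      (LinearIndependent ℚ x ∧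
        Algebra.trdeg ℚ ↥(IntermediateField.adjoin ℚ (Set.range x ∪ Set.range (Complex.exp ∘ x))) <
          (n : Cardinal) ∧
        ∀ r < n, Literature.NumberTheory.Transcendental.SchanuelRank r) →
      Set.Finite {x' : Fin n → ℂ | LinearIndependent ℚ x' ∧
          ∀ p : MvPolynomial (Fin n ⊕ Fin n) ℚ,
            MvPolynomial.aeval (Sum.elim x (Complex.exp ∘ x)) p = 0 →
              MvPolynomial.aeval (Sum.elim x' (Complex.exp ∘ x')) p = 0} →
      ∀ i : Fin n, ∃ s : Set ℂ, s.Finite ∧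
        Set.Definable₁ (∅ : Set ℂ) Literature.ModelTheory.ExponentialFields.Language.expRing s ∧ x i ∈ s :=
  fun hx hfin i => isolationFree hx.1 hfin i

/-- Readable corollary (T1 with the tree's `locusMates` vocabulary of `Negative.LocusMates`): every locus
mate of a first failure has predimension `≤ −1`. -/
theorem predim_le_neg_one_of_mem_locusMates {n : ℕ} {x : Fin n → ℂ}
    (hx : LinearIndependent ℚ x ∧
      Algebra.trdeg ℚ ↥(IntermediateField.adjoin ℚ (range x ∪ range (cexp ∘ x))) < (n : Cardinal) ∧
      ∀ r < n, SchanuelRank r)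
    {x' : Fin n → ℂ} (hx' : x' ∈ locusMates x) :
    GammaField.predim (⊥ : Submodule ℚ ℂ) (Submodule.span ℚ (range x')) ≤ -1 :=
  stub_matePredim hx hx'

end Summit.Schanuel.Schanuel.Cruxes.MinimalCounterexampleInAcl.SpanGrowthDichotomy

end
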